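import Literature.NumberTheory.Automorphic.GLnCuspidalSpectrumSiegel
import Literature.Analysis.Calculus.SmoothAlongExp
import HarnessLib

/-!
# Test functions on `GL_n(𝔸_K)` are smooth on `GL_n(K_∞)` in the ordinary sense

Topic `NumberTheory/Automorphic`. The tree's test functions `IsTestFunctionGL n K η`
(`GLnCuspidalSpectrumSiegel`; Garrett (2018), §6.3) are smooth in the archimedean variable in the
chart-wise sense of Borel–Jacquet (`IsArchSmooth` of `ArchimedeanCalculus`: for every
`g ∈ GL_n(𝔸_K)`, `X ↦ η(g · (exp X, 1))` is `C^∞` on `𝔤𝔩_n(K_∞)`). For the integrations by parts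
in the archimedean variable behind the Schwartz estimates of the basic estimate for cusp forms
(Garrett (2018), Claim 7.3.9 and PDF p. 340; Getz–Hahn (2024), Prop. 9.5.3) one needs genuine
derivatives in the group variable, continuous in all parameters. This file PROVES that chart-wise
smoothness is ordinary smoothness (`Literature.Analysis.Calculus.contDiffAt_of_contDiffAt_comp_mul_exp`,
the local logarithm of the Banach algebra `M_n(K_∞)`):

* `glArchLift η g` — the function `x ↦ η(g · (x, 1))` on the matrix algebra `M_n(K_∞)`
  (`K_∞ ≅ mixedSpace K = ℝ^{r₁} × ℂ^{r₂}`), extended by `0` off the open set `GL_n(K_∞)` of units;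
  `glArchLift_coe`.
* `IsTestFunctionGL.contDiffAt_glArchLift` — **for a test function `η`, every `g ∈ GL_n(𝔸_K)` and
  every `u ∈ GL_n(K_∞)`, `glArchLift η g` is `C^∞` at `u`** (with respect to the real Banach algebra
  structure of `M_n(K_∞)` given by the `L^∞` operator norm, the one through which `IsArchSmooth` is
  defined); more generally `contDiffAt_glArchLift_of_isArchSmooth` for any real `η` with
  `IsArchSmooth` for the `GL_n` datum.

## References

* A. Borel, H. Jacquet, *Automorphic forms and automorphic representations*, Corvallis (1979),
  §1.1, §4.1 [BorelJacquet1979].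
* P. Garrett, *Modern Analysis of Automorphic Forms by Example* (2018), §6.3 (PDF pp. 274–275),
  §7.3 Claim 7.3.9 (PDF p. 338) [Garrett2018].
-/

-- Mathlib idiom (Mathlib/Algebra/Lie/OfAssociative.lean); needed to mention Lie subalgebras of matrix algebras
attribute [local instance 100] LieRing.ofAssociativeRing

noncomputable section

open scoped MatrixGroups Matrix ContDiff Classical
open NumberField NumberField.mixedEmbedding IsDedekindDomain

namespace Literature.NumberTheory.Automorphic

variable {n : ℕ} {K : Type} [Field K] [NumberField K]

-- the Banach algebra structure of `M_n(K_∞)` through which `IsArchSmooth` is defined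
open scoped Matrix.Norms.Operator

/-- The archimedean lift `x ↦ η(g · (x, 1))` of `η : GL_n(𝔸_K) → ℝ` at the base point `g`, as a
complex-valued function on the matrix algebra `M_n(K_∞)` (value `0` at non-invertible `x`).
[folklore] -/
def glArchLift (η : GL (Fin n) (AdeleRing (𝓞 K) K) → ℝ) (g : GL (Fin n) (AdeleRing (𝓞 K) K))
    (x : Matrix (Fin n) (Fin n) (mixedSpace K)) : ℂ :=
  if h : IsUnit x then (η (g * GLn.ofInfinite n K h.unit) : ℂ) else 0

/-- On invertible matrices the lift is `η(g · (u, 1))`. [folklore] -/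
theorem glArchLift_coe (η : GL (Fin n) (AdeleRing (𝓞 K) K) → ℝ) (g : GL (Fin n) (AdeleRing (𝓞 K) K))
    (u : GL (Fin n) (mixedSpace K)) :
    glArchLift η g (u : Matrix (Fin n) (Fin n) (mixedSpace K)) = (η (g * GLn.ofInfinite n K u) : ℂ) := by
  unfold glArchLift
  rw [dif_pos (Units.isUnit u), IsUnit.unit_of_val_units]

/-- Every matrix lies in the Lie algebra `𝔤𝔩_n(K_∞) = ⊤` of `archGroupGL n K`. [folklore] -/
theorem mem_archGroupGL_lie_toSubmodule (x : Matrix (Fin n) (Fin n) (mixedSpace K)) :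
    x ∈ (archGroupGL n K).lie.toSubmodule := by
  change x ∈ (archGroupGL n K).lie
  rw [archGroupGL_lie]
  exact LieSubalgebra.mem_top x

/-- The identity `M_n(K_∞) → 𝔤𝔩_n(K_∞)` onto the (full) Lie algebra, as a continuous linear map.
[folklore] -/
def toArchLie : Matrix (Fin n) (Fin n) (mixedSpace K) →L[ℝ] (archGroupGL n K).lie.toSubmodule where
  toFun x := ⟨x, mem_archGroupGL_lie_toSubmodule x⟩
  map_add' _ _ := rfl
  map_smul' _ _ := rfl
  cont := continuous_id.subtype_mk _

-- `Matrix` is a type synonym of a pi type; its scoped Banach-algebra instances are found through it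
-- (the idiom of Mathlib's `Matrix.isUnit_exp`, `Mathlib/Analysis/Normed/Algebra/MatrixExponential`)
set_option backward.isDefEq.respectTransparency false in
/-- **Chart-wise archimedean smoothness is smoothness on `GL_n(K_∞)`**: if `η : GL_n(𝔸_K) → ℝ` is
`IsArchSmooth` for the `GL_n` datum then for every `g ∈ GL_n(𝔸_K)` the lift `x ↦ η(g · (x, 1))` is
`C^∞` at every invertible `x` (local logarithm chart, `Literature.Analysis.Calculus`).
[folklore] -/
theorem contDiffAt_glArchLift_of_isArchSmooth {η : GL (Fin n) (AdeleRing (𝓞 K) K) → ℝ}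
    (hη : IsArchSmooth (AutomorphyDatum.gl n K (isCompact_glFiniteIntegralLevel_holds n K)).ofArch
      (fun g => (η g : ℂ)))
    (g : GL (Fin n) (AdeleRing (𝓞 K) K)) (u : GL (Fin n) (mixedSpace K)) :
    ContDiffAt ℝ ∞ (glArchLift η g) (u : Matrix (Fin n) (Fin n) (mixedSpace K)) := by
  refine Literature.Analysis.Calculus.contDiffAt_of_contDiffAt_comp_mul_exp u ?_
  -- the chart function at the base point `g · (u, 1)`
  have hsm : ContDiff ℝ ∞ fun X : (archGroupGL n K).lie.toSubmodule =>
      ((η (g * GLn.ofInfinite n K u *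
        GLn.ofInfinite n K (expGL (X : Matrix (Fin n) (Fin n) (mixedSpace K))))) : ℂ) :=
    hη (g * GLn.ofInfinite n K u)
  have hcomp : ContDiff ℝ ∞ ((fun X : (archGroupGL n K).lie.toSubmodule =>
      ((η (g * GLn.ofInfinite n K u *
        GLn.ofInfinite n K (expGL (X : Matrix (Fin n) (Fin n) (mixedSpace K))))) : ℂ)) ∘
        (toArchLie : Matrix (Fin n) (Fin n) (mixedSpace K) → _)) :=
    hsm.comp (toArchLie (n := n) (K := K)).contDiff
  have heq : (fun X : Matrix (Fin n) (Fin n) (mixedSpace K) =>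
      glArchLift η g ((u : Matrix (Fin n) (Fin n) (mixedSpace K)) * NormedSpace.exp X)) =
      ((fun X : (archGroupGL n K).lie.toSubmodule =>
        ((η (g * GLn.ofInfinite n K u *
          GLn.ofInfinite n K (expGL (X : Matrix (Fin n) (Fin n) (mixedSpace K))))) : ℂ)) ∘
        (toArchLie : Matrix (Fin n) (Fin n) (mixedSpace K) → _)) := by
    funext X
    change glArchLift η g ((u : Matrix (Fin n) (Fin n) (mixedSpace K)) * NormedSpace.exp X) =
      (η (g * GLn.ofInfinite n K u * GLn.ofInfinite n K (expGL X)) : ℂ)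
    have hX : ((u : Matrix (Fin n) (Fin n) (mixedSpace K)) * NormedSpace.exp X : Matrix (Fin n) (Fin n) (mixedSpace K)) =
        ((u * expGL X : GL (Fin n) (mixedSpace K)) : Matrix (Fin n) (Fin n) (mixedSpace K)) := by
      rw [Units.val_mul, coe_expGL]
    rw [hX, glArchLift_coe, map_mul, mul_assoc]
  rw [heq]
  exact hcomp.contDiffAt

set_option backward.isDefEq.respectTransparency false in
/-- **Test functions on `GL_n(𝔸_K)` are `C^∞` on `GL_n(K_∞)`**: for `η` a test function
(`IsTestFunctionGL`), every `g ∈ GL_n(𝔸_K)` and every `u ∈ GL_n(K_∞)`, the lift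
`x ↦ η(g · (x, 1))` is `C^∞` at `u`. [cite: Garrett2018, §6.3 (PDF pp. 274–275)] -/
theorem IsTestFunctionGL.contDiffAt_glArchLift {η : GL (Fin n) (AdeleRing (𝓞 K) K) → ℝ}
    (hη : IsTestFunctionGL n K η) (g : GL (Fin n) (AdeleRing (𝓞 K) K))
    (u : GL (Fin n) (mixedSpace K)) :
    ContDiffAt ℝ ∞ (glArchLift η g) (u : Matrix (Fin n) (Fin n) (mixedSpace K)) :=
  contDiffAt_glArchLift_of_isArchSmooth hη.isArchSmooth g u

set_option backward.isDefEq.respectTransparency false in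
/-- The real-valued form: `x ↦ η(g · (x, 1))` (real part of the lift) is `C^∞` at every unit.
[folklore] -/
theorem IsTestFunctionGL.contDiffAt_re_glArchLift {η : GL (Fin n) (AdeleRing (𝓞 K) K) → ℝ}
    (hη : IsTestFunctionGL n K η) (g : GL (Fin n) (AdeleRing (𝓞 K) K))
    (u : GL (Fin n) (mixedSpace K)) :
    ContDiffAt ℝ ∞ (fun x => (glArchLift η g x).re) (u : Matrix (Fin n) (Fin n) (mixedSpace K)) :=
  Complex.reCLM.contDiff.contDiffAt.comp _ (hη.contDiffAt_glArchLift g u)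

end Literature.NumberTheory.Automorphic
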